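import Literature.NumberTheory.Automorphic.UnitaryGroupCentralOscillationSiegel
import Literature.NumberTheory.Automorphic.UnitaryGroupHeisenbergSingularTwist
import Literature.NumberTheory.Automorphic.UnitaryGroupSingularBorelBasePoint
import HarnessLib

/-!
# The centre family `F_{k,x}(y) = f(k⁻¹ · u(x)⁻¹ (γ₀ n(y)) u(x) · k)` of a test function at the singular class `γ₀ = d(a, b, a)`:
# uniform compact support in `(x, y)` and the oscillation bound along the dilated centre lattice cells
(Rogawski, *Automorphic Representations of Unitary Groups in Three Variables* (1990), §7.2 Prop. 7.2.1 pp. 93–95, §7.3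
p. 97 («`u(x)⁻¹ γ n(w) u(x) = γ u(A₁x) n(w + …)`»); Arthur, *A trace formula for reductive groups I*, Duke Math. J. 45 (1978), §8)

Topic `NumberTheory/Automorphic`; namespace `Literature.NumberTheory.Automorphic.UnitaryGroup`. THEOREMS ONLY over accepted tree
modules (no definition, no named fact, no instance, no notation, no `sorry`). Brick (F6b-1) of the row (L5-iii-b2) (b2-β)
«`|b_T| ∈ L¹(Z B_γ(F)∖G(𝔸))` for every `T`» of the T1-qs LAW 5 road of `Cruxes/H413/Lines/F0_T1InnerFormTraceIdentity.lean`
(cell `pub/hodgecm-mathlib`, crux H413). Along `t · u(x, y) · k` Rogawski's bracket `b_T` at the singular class is the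
centre-line lattice sum of the FAMILY (spelled inline, no definition)

  `F_{k,x}(y) := f (k⁻¹ * (u(x)⁻¹ * (γ₀ * n(y)) * u(x)) * k)`, `u(x) = heisElt hc x 0`, `n(y) = heisElt hc 0 y`,

sampled at `y = a_t • w`, `w ∈ E⁻ ∖ 0`, `a_t = (d₀⁻¹d₂)(t)` (★ A-p14 `UnitaryGroupSingularHeisenbergFibre`). This file supplies the
two inputs the generic lattice-sum bounds ★ (F6a-2) `TraceZeroCentreLineLatticeSum` ask of the family:

* §1 **UNIFORM COMPACT SUPPORT** `exists_isCompact_support_singularCentreFamily`: compacta `C_X ⊆ 𝔸_E`, `C_Y ⊆ 𝔸_E⁻` with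
  `F_{k,x}(y) ≠ 0 ⇒ x ∈ C_X ∧ y ∈ C_Y` for all `k ∈ K_U` — the singular twist ★ `inv_heisElt_mul_mul_heisElt_zero_mul_heisElt`
  (`u(x)⁻¹ γ₀ n(y) u(x) = γ₀ u(l₁x, q(x) + y)`) turns the support condition into membership of `(l₁x, q(x) + y)` in a compact
  subset of the Heisenberg chart; and `exists_forall_norm_le_of_isQuasiSplitTest` (`‖f‖ ≤ M`).
* §2 **TRANSLATION ALONG THE CENTRE** `singularCentreFamily_add_torus_smul`: `F_{k,x}(y + a_t • d) = f(g · (t k)⁻¹ n(d) (t k))` with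
  `g = k⁻¹ u(x)⁻¹ γ₀ n(y) u(x) k` (`n(·)` is central in `N(𝔸_F)`, ★ `heisElt_zero_mul_comm`, and `t⁻¹ n(d) t = n(a_t d)`), hence
  §3 **THE OSCILLATION BOUND** `exists_forall_norm_singularCentreFamily_sub_le_rpow`: with the `m, C` of ★ (F5)
  `IsQuasiSplitTest.exists_forall_norm_sub_conj_center_le_rpow`, for `t` in the torus Siegel set of height `≥ 1`, `k ∈ K_U`,
  `v ∈ V`: `‖F_{k,x}(y) − F_{k,x}(y + a_t • (m • v))‖ ≤ C · H(t)^{−1∕[E:ℚ]}` — the `hω` premise of ★ (F6a-2) with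
  `ω = C · H(t)^{−1∕[E:ℚ]}`.

## References
* J. D. Rogawski, *Automorphic Representations of Unitary Groups in Three Variables*, Ann. of Math. Stud. 123 (1990), §7.2
  Prop. 7.2.1 (pp. 93–95), §7.3 (p. 97) [Rogawski1990].
* J. Arthur, *A trace formula for reductive groups I*, Duke Math. J. 45 (1978), §8 [Arthur1978TraceFormulaI].
-/

set_option autoImplicit false

noncomputable section

open MeasureTheory NumberField IsDedekindDomain Set Topology
open scoped NNReal Pointwise

namespace Literature.NumberTheory.Automorphic

namespace UnitaryGroup

variable {F E : Type} [Field F] [NumberField F] [Field E] [NumberField E] [Algebra F E]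
  {c : E ≃ₐ[F] E}

/-! ## §1 Uniform compact support of the centre family and the sup bound of `f` -/

section Support

/-- `N(𝔸_F)` is closed in `U(J₃)(𝔸_F)` (preimage of the closed upper unitriangular group). [folklore] -/
private theorem isClosed_adelicUnipotent₆ : IsClosed ((adelicUnipotent F E c 3 : Set (quasiSplit F E c 3).Adelic)) := by
  haveI := t2Space_adeleRing_of_numberField E
  change IsClosed (⇑(adelicVal F E c 3 ((StdForm.antidiagonal 3).over E)) ⁻¹'
    ((upperUnitriangular (Fin 3) (AdeleRing (𝓞 E) E) : Subgroup (GL (Fin 3) (AdeleRing (𝓞 E) E))) :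
      Set (GL (Fin 3) (AdeleRing (𝓞 E) E))))
  exact (isClosed_upperUnitriangular (R := AdeleRing (𝓞 E) E)).preimage continuous_subtype_val

/-- **A test function is bounded**: `∃ M ≥ 0, ‖f‖ ≤ M` (continuous with compact support). [cite: Rogawski1990, §2.1 (pp. 11–12)] -/
theorem exists_forall_norm_le_of_isQuasiSplitTest {f : (quasiSplit F E c 3).Adelic → ℂ} (hf : IsQuasiSplitTest F E c 3 f) :
    ∃ M : ℝ, 0 ≤ M ∧ ∀ g, ‖f g‖ ≤ M := by
  obtain ⟨M, hM⟩ := hf.hasCompactSupport'.exists_bound_of_continuous hf.continuous'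
  exact ⟨max M 0, le_max_right _ _, fun g => (hM g).trans (le_max_left _ _)⟩

/-- **UNIFORM COMPACT SUPPORT OF THE CENTRE FAMILY.** For `f` with compact support and the singular base point `γ₀ = d(a, b, a)`
there are compacta `C_X ⊆ 𝔸_E`, `C_Y ⊆ 𝔸_E⁻` such that for every `k ∈ K_U` and all `x, y`:
`f(k⁻¹ · u(x)⁻¹ (γ₀ n(y)) u(x) · k) ≠ 0 ⇒ x ∈ C_X ∧ y ∈ C_Y` (singular twist: `u(x)⁻¹ γ₀ n(y) u(x) = γ₀ u(l₁x, q(x) + y)`, so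
`(l₁x, q(x)+y)` lies in the compact chart-preimage of `γ₀⁻¹ · K_U (supp f) K_U⁻¹ ∩ N(𝔸_F)`; `l₁ = 1 − a⁻¹b` is a unit).
[cite: Rogawski1990, §7.3 (p. 97)] [cite: Rogawski1990, §7.2 Prop. 7.2.1 (pp. 93–95)] -/
theorem exists_isCompact_support_singularCentreFamily (hc : c * c = 1) {a b : Eˣ} (hab : (a : E) ≠ (b : E))
    {g₀ : (quasiSplit F E c 3).Rational} {γ₀ : (quasiSplit F E c 3).arithmeticSubgroup}
    (hg₀ : ((g₀.val : GL (Fin 3) E) : Matrix (Fin 3) (Fin 3) E) = !![(a : E), 0, 0; 0, b, 0; 0, 0, a])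
    (hγ₀ : (γ₀ : (quasiSplit F E c 3).Adelic) = (quasiSplit F E c 3).toAdelic g₀)
    {f : (quasiSplit F E c 3).Adelic → ℂ} (hfs : HasCompactSupport f) :
    ∃ (C_X : Set (AdeleRing (𝓞 E) E)) (C_Y : Set (traceZeroAdele F E c)), IsCompact C_X ∧ IsCompact C_Y ∧
      ∀ k : (quasiSplit F E c 3).Adelic, adelicVal F E c 3 _ k ∈ standardMaximalCompactGL 3 E →
      ∀ (x : AdeleRing (𝓞 E) E) (y : traceZeroAdele F E c),
        f (k⁻¹ * ((((heisElt hc x (0 : traceZeroAdele F E c) : unipotentInBorel F E c 3) : borelAdelic F E c 3) :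
              (quasiSplit F E c 3).Adelic)⁻¹ *
            ((γ₀ : (quasiSplit F E c 3).Adelic) *
              (((heisElt hc 0 y : unipotentInBorel F E c 3) : borelAdelic F E c 3) : (quasiSplit F E c 3).Adelic)) *
            (((heisElt hc x (0 : traceZeroAdele F E c) : unipotentInBorel F E c 3) : borelAdelic F E c 3) :
              (quasiSplit F E c 3).Adelic)) * k) ≠ 0 → x ∈ C_X ∧ y ∈ C_Y := by
  haveI := t2Space_adeleRing_of_numberField E
  haveI : T2Space (quasiSplit F E c 3).Adelic := inferInstanceAs (T2Space (adelic F E c 3 ((StdForm.antidiagonal 3).over E)))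
  -- `γ₀` as a torus element and its diagonal
  have hγT : (γ₀ : (quasiSplit F E c 3).Adelic) ∈ torusAdelic F E c 3 := coe_mem_torusAdelic_of_eq_diag hg₀ hγ₀
  set tγ : torusInBorel F E c 3 := ⟨⟨(γ₀ : (quasiSplit F E c 3).Adelic), torusAdelic_le_borelAdelic hγT⟩,
    (mem_torusInBorel_iff _).2 hγT⟩ with htγ
  have hd := glDiagonal_diagUnit_torus tγ
  set d := diagUnit (tγ : borelAdelic F E c 3).2 with hddef
  -- the unit `l₁ = 1 − d₀⁻¹ d₁`
  have hd0 : (d 0 : AdeleRing (𝓞 E) E) = algebraMap E (AdeleRing (𝓞 E) E) (a : E) := by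
    have h := congrFun (congrFun (congrArg (fun M : GL (Fin 3) (AdeleRing (𝓞 E) E) =>
      (M : Matrix (Fin 3) (Fin 3) (AdeleRing (𝓞 E) E))) hd) 0) 0
    rw [coe_glDiagonal, Matrix.diagonal_apply_eq] at h
    rw [h]
    change ((adelicVal F E c 3 _ (γ₀ : (quasiSplit F E c 3).Adelic) : GL (Fin 3) (AdeleRing (𝓞 E) E)) :
      Matrix (Fin 3) (Fin 3) (AdeleRing (𝓞 E) E)) 0 0 = _
    rw [hγ₀]
    change (((g₀.val : GL (Fin 3) E) : Matrix (Fin 3) (Fin 3) E).map (algebraMap E (AdeleRing (𝓞 E) E))) 0 0 = _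
    rw [hg₀]; rfl
  have hd1 : (d 1 : AdeleRing (𝓞 E) E) = algebraMap E (AdeleRing (𝓞 E) E) (b : E) := by
    have h := congrFun (congrFun (congrArg (fun M : GL (Fin 3) (AdeleRing (𝓞 E) E) =>
      (M : Matrix (Fin 3) (Fin 3) (AdeleRing (𝓞 E) E))) hd) 1) 1
    rw [coe_glDiagonal, Matrix.diagonal_apply_eq] at h
    rw [h]
    change ((adelicVal F E c 3 _ (γ₀ : (quasiSplit F E c 3).Adelic) : GL (Fin 3) (AdeleRing (𝓞 E) E)) :
      Matrix (Fin 3) (Fin 3) (AdeleRing (𝓞 E) E)) 1 1 = _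
    rw [hγ₀]
    change (((g₀.val : GL (Fin 3) E) : Matrix (Fin 3) (Fin 3) E).map (algebraMap E (AdeleRing (𝓞 E) E))) 1 1 = _
    rw [hg₀]; rfl
  have hk1 : (1 : E) - ((a⁻¹ * b : Eˣ) : E) ≠ 0 := by
    intro h
    apply hab
    have h1 : ((a⁻¹ * b : Eˣ) : E) = 1 := (sub_eq_zero.mp h).symm
    have h2 : a⁻¹ * b = 1 := Units.ext h1
    rw [eq_of_inv_mul_eq_one h2]
  set l₁ : (AdeleRing (𝓞 E) E)ˣ := Units.map (algebraMap E (AdeleRing (𝓞 E) E) : E →* AdeleRing (𝓞 E) E) (Units.mk0 _ hk1)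
    with hl₁
  have hl₁eq : (l₁ : AdeleRing (𝓞 E) E) = 1 - (((d 0)⁻¹ * d 1 : (AdeleRing (𝓞 E) E)ˣ) : AdeleRing (𝓞 E) E) := by
    have hinv : (((d 0)⁻¹ : (AdeleRing (𝓞 E) E)ˣ) : AdeleRing (𝓞 E) E) = algebraMap E (AdeleRing (𝓞 E) E) ((a⁻¹ : Eˣ) : E) := by
      refine Units.inv_eq_of_mul_eq_one_left ?_
      rw [hd0, ← map_mul, Units.inv_mul, map_one]
    rw [hl₁, Units.coe_map, MonoidHom.coe_coe, Units.val_mk0, map_sub, map_one]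
    congr 1
    simp only [Units.val_mul, hinv, hd1, map_mul]
  -- compacta: `K_U`, `supp f`, and the chart preimage
  set KU : Set (quasiSplit F E c 3).Adelic := (↑((standardMaximalCompactGL 3 E).comap
    (adelicVal F E c 3 ((StdForm.antidiagonal 3).over E))) : Set (quasiSplit F E c 3).Adelic) with hKU
  have hKUc : IsCompact KU := isCompact_comap_adelicVal_standardMaximalCompactGL
  set Ω : Set (quasiSplit F E c 3).Adelic := tsupport f with hΩ
  have hΩc : IsCompact Ω := hfs
  set Ω₁ : Set (quasiSplit F E c 3).Adelic := KU * Ω * KU⁻¹ with hΩ₁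
  have hΩ₁c : IsCompact Ω₁ := (hKUc.mul hΩc).mul hKUc.inv
  set Ω₂ : Set (quasiSplit F E c 3).Adelic := (fun g => (γ₀ : (quasiSplit F E c 3).Adelic)⁻¹ * g) '' Ω₁ with hΩ₂
  have hΩ₂c : IsCompact Ω₂ := hΩ₁c.image (continuous_const.mul continuous_id)
  set K₁ : Set (AdeleRing (𝓞 E) E × traceZeroAdele F E c) :=
    (fun p => ((heisChart hc p : adelicUnipotent F E c 3) : (quasiSplit F E c 3).Adelic)) ⁻¹' Ω₂ with hK₁
  have hK₁c : IsCompact K₁ := by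
    have h1 : IsCompact (((↑) : adelicUnipotent F E c 3 → (quasiSplit F E c 3).Adelic) ⁻¹' Ω₂) :=
      isClosed_adelicUnipotent₆.isClosedEmbedding_subtypeVal.isCompact_preimage hΩ₂c
    exact (heisChart hc).isCompact_preimage.2 h1
  have hq : Continuous fun x : AdeleRing (𝓞 E) E => (⟨_, twistShift_mem hc tγ hd x⟩ : traceZeroAdele F E c) :=
    (continuous_const.mul (continuous_id.mul (continuous_conjAdele F E c))).subtype_mk _
  set C_X : Set (AdeleRing (𝓞 E) E) := (fun z => ((l₁⁻¹ : (AdeleRing (𝓞 E) E)ˣ) : AdeleRing (𝓞 E) E) * z) '' (Prod.fst '' K₁)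
    with hCX
  have hCXc : IsCompact C_X := (hK₁c.image continuous_fst).image (continuous_const.mul continuous_id)
  set C_Y : Set (traceZeroAdele F E c) := Prod.snd '' K₁ - (fun x => (⟨_, twistShift_mem hc tγ hd x⟩ : traceZeroAdele F E c)) '' C_X
    with hCY
  have hCYc : IsCompact C_Y := by
    rw [hCY, sub_eq_add_neg]
    exact (hK₁c.image continuous_snd).add (hCXc.image hq).neg
  refine ⟨C_X, C_Y, hCXc, hCYc, fun k hk x y hne => ?_⟩
  -- the point `X = u(x)⁻¹ γ₀ n(y) u(x)` lies in `Ω₁`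
  set U : (quasiSplit F E c 3).Adelic := (((heisElt hc x (0 : traceZeroAdele F E c) : unipotentInBorel F E c 3) :
    borelAdelic F E c 3) : (quasiSplit F E c 3).Adelic) with hU
  set Ny : (quasiSplit F E c 3).Adelic := (((heisElt hc 0 y : unipotentInBorel F E c 3) : borelAdelic F E c 3) :
    (quasiSplit F E c 3).Adelic) with hNy
  set X : (quasiSplit F E c 3).Adelic := U⁻¹ * ((γ₀ : (quasiSplit F E c 3).Adelic) * Ny) * U with hX
  have hkKU : k ∈ KU := Subgroup.mem_comap.2 hk
  have hXΩ₁ : X ∈ Ω₁ := by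
    have hz : k⁻¹ * X * k ∈ Ω := subset_tsupport _ (Function.mem_support.2 hne)
    refine ⟨k * (k⁻¹ * X * k), Set.mul_mem_mul hkKU hz, k⁻¹, Set.inv_mem_inv.2 hkKU, by group⟩
  -- the twist: `γ₀⁻¹ X = u(l₁ x, q(x) + y)`
  have htw := inv_heisElt_mul_mul_heisElt_zero_mul_heisElt hc tγ hd x y
  have hX' : (γ₀ : (quasiSplit F E c 3).Adelic)⁻¹ * X =
      ((heisChart hc (((1 - (((d 0)⁻¹ * d 1 : (AdeleRing (𝓞 E) E)ˣ) : AdeleRing (𝓞 E) E)) * x),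
        (⟨_, twistShift_mem hc tγ hd x⟩ : traceZeroAdele F E c) + y) : adelicUnipotent F E c 3) :
          (quasiSplit F E c 3).Adelic) := by
    rw [coe_heisChart]
    have h := congrArg (fun z : borelAdelic F E c 3 => (z : (quasiSplit F E c 3).Adelic)) htw
    simp only [Subgroup.coe_mul, InvMemClass.coe_inv] at h
    change U⁻¹ * (γ₀ : (quasiSplit F E c 3).Adelic) * Ny * U = (γ₀ : (quasiSplit F E c 3).Adelic) * _ at h
    rw [hX, show U⁻¹ * ((γ₀ : (quasiSplit F E c 3).Adelic) * Ny) * U = U⁻¹ * (γ₀ : (quasiSplit F E c 3).Adelic) * Ny * U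
      by group, h, ← mul_assoc, inv_mul_cancel, one_mul]
  have hmemK₁ : ((((1 - (((d 0)⁻¹ * d 1 : (AdeleRing (𝓞 E) E)ˣ) : AdeleRing (𝓞 E) E)) * x),
      (⟨_, twistShift_mem hc tγ hd x⟩ : traceZeroAdele F E c) + y) : AdeleRing (𝓞 E) E × traceZeroAdele F E c) ∈ K₁ := by
    change ((heisChart hc _ : adelicUnipotent F E c 3) : (quasiSplit F E c 3).Adelic) ∈ Ω₂
    rw [← hX']
    exact ⟨X, hXΩ₁, rfl⟩
  have hxC : x ∈ C_X := by
    refine ⟨(1 - (((d 0)⁻¹ * d 1 : (AdeleRing (𝓞 E) E)ˣ) : AdeleRing (𝓞 E) E)) * x, ⟨_, hmemK₁, rfl⟩, ?_⟩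
    change ((l₁⁻¹ : (AdeleRing (𝓞 E) E)ˣ) : AdeleRing (𝓞 E) E) * ((1 - _) * x) = x
    rw [← hl₁eq, Units.inv_mul_cancel_left]
  refine ⟨hxC, ?_⟩
  refine ⟨(⟨_, twistShift_mem hc tγ hd x⟩ : traceZeroAdele F E c) + y, ⟨_, hmemK₁, rfl⟩,
    (⟨_, twistShift_mem hc tγ hd x⟩ : traceZeroAdele F E c), ⟨x, hxC, rfl⟩, ?_⟩
  abel

end Support

/-! ## §2 Translation along the centre: `F_{k,x}(y + a_t • d) = f(g · (t k)⁻¹ n(d) (t k))` -/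

section Translation

/-- `t⁻¹ n(w) t = n(a_t • w)` for a torus element `t = diag(d)`, `a_t = d₀⁻¹d₂` (★ `heisX_conjBy`, ★ `coe_heisY_conjBy`).
[cite: Rogawski1990, §1.10] -/
theorem torus_inv_mul_heisElt_zero_mul_torus (hc : c * c = 1) (t : torusInBorel F E c 3) {d : Fin 3 → (AdeleRing (𝓞 E) E)ˣ}
    (hd : glDiagonal 3 (AdeleRing (𝓞 E) E) d = adelicVal F E c 3 _ ((t : borelAdelic F E c 3) : (quasiSplit F E c 3).Adelic))
    (w : traceZeroAdele F E c) :
    ((t : borelAdelic F E c 3) : (quasiSplit F E c 3).Adelic)⁻¹ *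
        (((heisElt hc 0 w : unipotentInBorel F E c 3) : borelAdelic F E c 3) : (quasiSplit F E c 3).Adelic) *
        ((t : borelAdelic F E c 3) : (quasiSplit F E c 3).Adelic) =
      (((heisElt hc 0 (smulTraceZero ((d 0)⁻¹ * d 2) (conjAdele_torusCentralScalar t hd) w) : unipotentInBorel F E c 3) :
        borelAdelic F E c 3) : (quasiSplit F E c 3).Adelic) := by
  have h : isTopSemidirect_borelAdelic.conjBy t (heisElt hc 0 w) =
      heisElt hc 0 (smulTraceZero ((d 0)⁻¹ * d 2) (conjAdele_torusCentralScalar t hd) w) := by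
    apply (heisHomeomorph hc).symm.injective
    rw [heisHomeomorph_symm_apply, heisHomeomorph_symm_apply]
    refine Prod.ext ?_ (Subtype.ext ?_)
    · change heisX (isTopSemidirect_borelAdelic.conjBy t (heisElt hc 0 w)) = heisX (heisElt hc 0 _)
      rw [heisX_conjBy t hd, heisX_heisElt, heisX_heisElt, mul_zero]
    · change (heisY hc (isTopSemidirect_borelAdelic.conjBy t (heisElt hc 0 w)) : AdeleRing (𝓞 E) E) = (heisY hc (heisElt hc 0 _) : _)
      rw [coe_heisY_conjBy hc t hd, heisY_heisElt, heisY_heisElt, coe_smulTraceZero]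
  have h' := congrArg (fun z : unipotentInBorel F E c 3 => ((z : borelAdelic F E c 3) : (quasiSplit F E c 3).Adelic)) h
  exact h'

/-- **TRANSLATION ALONG THE CENTRE.** For a torus element `t = diag(d)`, `a_t = d₀⁻¹d₂`, and any `k, x, y, w`:
`F_{k,x}(y + a_t • w) = f (g · ((t k)⁻¹ · n(w) · (t k)))` with `g = k⁻¹ · u(x)⁻¹ (γ₀ n(y)) u(x) · k` — `n(y + a_t w) = n(y) n(a_t w)`,
`n(·)` is central in `N(𝔸_F)`, and `n(a_t w) = t⁻¹ n(w) t`. [cite: Rogawski1990, §7.2 Prop. 7.2.1 (pp. 93–95)] -/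
theorem singularCentreFamily_add_torus_smul (hc : c * c = 1) (γ : (quasiSplit F E c 3).Adelic)
    (t : torusInBorel F E c 3) {d : Fin 3 → (AdeleRing (𝓞 E) E)ˣ}
    (hd : glDiagonal 3 (AdeleRing (𝓞 E) E) d = adelicVal F E c 3 _ ((t : borelAdelic F E c 3) : (quasiSplit F E c 3).Adelic))
    (f : (quasiSplit F E c 3).Adelic → ℂ) (k : (quasiSplit F E c 3).Adelic) (x : AdeleRing (𝓞 E) E)
    (y w : traceZeroAdele F E c) :
    f (k⁻¹ * ((((heisElt hc x (0 : traceZeroAdele F E c) : unipotentInBorel F E c 3) : borelAdelic F E c 3) :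
              (quasiSplit F E c 3).Adelic)⁻¹ *
            (γ * (((heisElt hc 0 (y + smulTraceZero ((d 0)⁻¹ * d 2) (conjAdele_torusCentralScalar t hd) w) :
              unipotentInBorel F E c 3) : borelAdelic F E c 3) : (quasiSplit F E c 3).Adelic)) *
            (((heisElt hc x (0 : traceZeroAdele F E c) : unipotentInBorel F E c 3) : borelAdelic F E c 3) :
              (quasiSplit F E c 3).Adelic)) * k) =
      f ((k⁻¹ * ((((heisElt hc x (0 : traceZeroAdele F E c) : unipotentInBorel F E c 3) : borelAdelic F E c 3) :
              (quasiSplit F E c 3).Adelic)⁻¹ *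
            (γ * (((heisElt hc 0 y : unipotentInBorel F E c 3) : borelAdelic F E c 3) : (quasiSplit F E c 3).Adelic)) *
            (((heisElt hc x (0 : traceZeroAdele F E c) : unipotentInBorel F E c 3) : borelAdelic F E c 3) :
              (quasiSplit F E c 3).Adelic)) * k) *
        ((((t : borelAdelic F E c 3) : (quasiSplit F E c 3).Adelic) * k)⁻¹ *
          (((heisElt hc 0 w : unipotentInBorel F E c 3) : borelAdelic F E c 3) : (quasiSplit F E c 3).Adelic) *
          (((t : borelAdelic F E c 3) : (quasiSplit F E c 3).Adelic) * k))) := by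
  congr 1
  set U : (quasiSplit F E c 3).Adelic := (((heisElt hc x (0 : traceZeroAdele F E c) : unipotentInBorel F E c 3) :
    borelAdelic F E c 3) : (quasiSplit F E c 3).Adelic) with hU
  set T' : (quasiSplit F E c 3).Adelic := ((t : borelAdelic F E c 3) : (quasiSplit F E c 3).Adelic) with hT'
  set Ny : (quasiSplit F E c 3).Adelic := (((heisElt hc 0 y : unipotentInBorel F E c 3) : borelAdelic F E c 3) :
    (quasiSplit F E c 3).Adelic) with hNy
  set Nw : (quasiSplit F E c 3).Adelic := (((heisElt hc 0 w : unipotentInBorel F E c 3) : borelAdelic F E c 3) :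
    (quasiSplit F E c 3).Adelic) with hNw
  set Naw : (quasiSplit F E c 3).Adelic := (((heisElt hc 0 (smulTraceZero ((d 0)⁻¹ * d 2)
    (conjAdele_torusCentralScalar t hd) w) : unipotentInBorel F E c 3) : borelAdelic F E c 3) : (quasiSplit F E c 3).Adelic) with hNaw
  -- `n(y + a w) = n(y) n(a w)` and `n(a w)` commutes with `u(x)`
  have hsplit : (((heisElt hc 0 (y + smulTraceZero ((d 0)⁻¹ * d 2) (conjAdele_torusCentralScalar t hd) w) :
      unipotentInBorel F E c 3) : borelAdelic F E c 3) : (quasiSplit F E c 3).Adelic) = Ny * Naw := by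
    rw [hNy, hNaw, ← Subgroup.coe_mul, ← Subgroup.coe_mul, heisElt_mul_heisElt_zero hc]
  have hcomm : Naw * U = U * Naw := by
    rw [hNaw, hU, ← Subgroup.coe_mul, ← Subgroup.coe_mul, heisElt_zero_mul_comm hc]; rfl
  have hconj : T'⁻¹ * Nw * T' = Naw := torus_inv_mul_heisElt_zero_mul_torus hc t hd w
  rw [hsplit]
  calc k⁻¹ * (U⁻¹ * (γ * (Ny * Naw)) * U) * k
      = k⁻¹ * (U⁻¹ * (γ * Ny) * (Naw * U)) * k := by group
    _ = k⁻¹ * (U⁻¹ * (γ * Ny) * U) * k * (k⁻¹ * Naw * k) := by rw [hcomm]; group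
    _ = k⁻¹ * (U⁻¹ * (γ * Ny) * U) * k * ((T' * k)⁻¹ * Nw * (T' * k)) := by rw [← hconj]; group

end Translation

/-! ## §3 The oscillation bound of the centre family on the torus Siegel set -/

section Oscillation

/-- **THE OSCILLATION BOUND OF THE CENTRE FAMILY.** For `f ∈ C_c^∞(U(J₃)(𝔸_F))`, a set `ST` of torus elements with the
root-compactum clause `hroot` and the BALANCE clause `hbal` of ★ `exists_torusSiegelSet`, and a compact `V ⊆ 𝔸_E⁻`, there are
`m : ℕ`, `m ≠ 0`, and `C ≥ 0` such that for every `t ∈ ST` of height `≥ 1` (with diagonal `d`), `k ∈ K_U`, `x`, `y`, `v ∈ V`,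
and every `γ`: `‖F_{k,x}(y) − F_{k,x}(y + (d₀⁻¹d₂) • ↑(m • v))‖ ≤ C · H(t)^{−1∕[E:ℚ]}` — ★ (F5) composed with §2.
[cite: Rogawski1990, §2.2 (p. 13), §7.2 Prop. 7.2.1 (p. 95)] [cite: Arthur1978TraceFormulaI, §8] -/
theorem exists_forall_norm_singularCentreFamily_sub_le_rpow (hc : c * c = 1)
    {f : (quasiSplit F E c 3).Adelic → ℂ} (hf : IsQuasiSplitTest F E c 3 f)
    {ST : Set (borelAdelic F E c 3)} (hSTt : ∀ t ∈ ST, torusPart t = t)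
    {R₂ : Set (AdeleRing (𝓞 E) E)} (hR₂ : IsCompact R₂)
    (hroot : ∀ t ∈ ST, 1 ≤ borelHeight (t : (quasiSplit F E c 3).Adelic) →
      (((diagUnit t.2 0)⁻¹ * diagUnit t.2 2 : (AdeleRing (𝓞 E) E)ˣ) : AdeleRing (𝓞 E) E) ∈ R₂)
    {κ : ℝ}
    (hbal : ∀ t ∈ ST, ∀ w : InfinitePlace E,
      ‖((((diagUnit t.2 0)⁻¹ * diagUnit t.2 1 : (AdeleRing (𝓞 E) E)ˣ) : AdeleRing (𝓞 E) E)).1 w‖ ≤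
        κ * ((borelHeight (t : (quasiSplit F E c 3).Adelic) : ℝ) ^ (-(1 / (Module.finrank ℚ E : ℝ)))))
    {V : Set (traceZeroAdele F E c)} (hV : IsCompact V) :
    ∃ m : ℕ, m ≠ 0 ∧ ∃ C : ℝ, 0 ≤ C ∧
      ∀ t : torusInBorel F E c 3, (t : borelAdelic F E c 3) ∈ ST →
        1 ≤ borelHeight ((t : borelAdelic F E c 3) : (quasiSplit F E c 3).Adelic) →
      ∀ k : (quasiSplit F E c 3).Adelic, adelicVal F E c 3 _ k ∈ standardMaximalCompactGL 3 E →
      ∀ (γ : (quasiSplit F E c 3).Adelic) (x : AdeleRing (𝓞 E) E) (y : traceZeroAdele F E c), ∀ v ∈ V,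
        ‖f (k⁻¹ * ((((heisElt hc x (0 : traceZeroAdele F E c) : unipotentInBorel F E c 3) : borelAdelic F E c 3) :
                (quasiSplit F E c 3).Adelic)⁻¹ *
              (γ * (((heisElt hc 0 y : unipotentInBorel F E c 3) : borelAdelic F E c 3) : (quasiSplit F E c 3).Adelic)) *
              (((heisElt hc x (0 : traceZeroAdele F E c) : unipotentInBorel F E c 3) : borelAdelic F E c 3) :
                (quasiSplit F E c 3).Adelic)) * k) -
          f (k⁻¹ * ((((heisElt hc x (0 : traceZeroAdele F E c) : unipotentInBorel F E c 3) : borelAdelic F E c 3) :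
                (quasiSplit F E c 3).Adelic)⁻¹ *
              (γ * (((heisElt hc 0 (y + smulTraceZero ((diagUnit (t : borelAdelic F E c 3).2 0)⁻¹ *
                  diagUnit (t : borelAdelic F E c 3).2 2) (conjAdele_torusCentralScalar t (glDiagonal_diagUnit_torus t))
                  (m • v)) : unipotentInBorel F E c 3) : borelAdelic F E c 3) : (quasiSplit F E c 3).Adelic)) *
              (((heisElt hc x (0 : traceZeroAdele F E c) : unipotentInBorel F E c 3) : borelAdelic F E c 3) :
                (quasiSplit F E c 3).Adelic)) * k)‖ ≤
          C * ((borelHeight ((t : borelAdelic F E c 3) : (quasiSplit F E c 3).Adelic) : ℝ) ^ (-(1 / (Module.finrank ℚ E : ℝ)))) := by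
  obtain ⟨m, hm0, C, hC0, h⟩ := hf.exists_forall_norm_sub_conj_center_le_rpow hc hSTt hR₂ hroot hbal hV
  refine ⟨m, hm0, C, hC0, fun t ht h1 k hk γ x y v hv => ?_⟩
  rw [singularCentreFamily_add_torus_smul hc γ t (glDiagonal_diagUnit_torus t) f k x y (m • v)]
  exact h (t : borelAdelic F E c 3) ht h1 k hk v hv _

end Oscillation

end UnitaryGroup

end Literature.NumberTheory.Automorphic

end
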